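import Literature.Topology.FourManifolds.LinkingNumberSymmProofs
import Literature.AlgebraicTopology.FundamentalGroup.CircleValuedWinding
import Literature.Topology.FourManifolds.CircleLoopNullhomotopy
import Literature.Topology.FourManifolds.HCobordismAuxiliaryPairProofs
import Literature.Topology.FourManifolds.SphereSimplyConnected
import Literature.Topology.FourManifolds.SphereFourCircleSurgery
import Literature.Topology.FourManifolds.CircleDiffeotopy
import Mathlib.AlgebraicTopology.FundamentalGroupoid.FundamentalGroup

/-!
# Crux `WeakReductionReduces` (stmt-SmoothPoincare4-17908), line `loop_dichotomy`, stub L₃ —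
# auxiliary file 3: loops in `S¹ × S³` normally generating `π₁` are the fibre circle or its
# reverse, up to homotopy — PROVED

The `π₁`-step of stub L₃ (`stub_loopFromGenusThree`): once the loop partner is `X ≅ S¹ × S³` and
the surgered `M = X_ℓ` is simply connected, `[ℓ]` normally generates `π₁(X) ≅ ℤ`, so `ℓ` is "the
loop `ℓ_{±1}`" of Aranda–Zupan 2025, §2 p. 7 ("let `ℓ_p` be any loop in `S¹ × S³` such that
`[ℓ_p] = p ∈ ℤ = π₁(S¹ × S³)`.  (Note that `ℓ_p` is well-defined up to isotopy, since homotopy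
and isotopy coincide for loops in dimension four.)"), i.e. homotopic to the fibre circle
`u ↦ (u, N)` or to its reverse — the hypothesis of the end-game of auxiliary file 1.  This file
PROVES that statement over Mathlib's `𝕊¹ × 𝕊³`:

* `helper_circleProdSphereThree_loop_homotopic_fibre` (registered helper): for
  `f : C(𝕊¹, 𝕊¹ × 𝕊³)` with `normalClosure {[f.circleLoop]} = ⊤` in `π₁(𝕊¹ × 𝕊³, f(1,0))`,
  `f ≃ (u ↦ (u, N)) ∨ f ≃ (u ↦ (ū, N))` (`N = SphereFourSurgery.northPole`, `ū = circleConj u`).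

Ingredients, all theorems of the tree: the winding HOMOMORPHISM of a map to `ℝ/ℤ` and its
evaluation by real lifts (`wind_fromPath_eq_of_lift`, `CircleValuedWinding.lean`; Hatcher
Thm. 1.7 / Prop. 1.30), the winding NUMBER and degree of circle-valued maps with the homotopy
classification of torus maps by degrees (`CircleMapWinding.lean`: `winding`, `degree`,
`homotopic_monomial_of_degree`), the homeomorphism `Circle ≃ₜ 𝕊¹`
(`circleHomeomorphSphereOne`, `…_exp`, `…_symm_circlePoint`), simple connectivity of `𝕊³`
(`simplyConnectedSpace_euclideanSphere`) and `ContinuousMap.homotopic_of_simplyConnectedSpace`.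
Steps: `eq_one_or_neg_one_of_normalClosure_eq_top` (group theory), `wind_eq_winding`,
`homotopic_zpow_of_degree` / `homotopic_id_or_conj_of_degree` (degree `±1` self-maps of `𝕊¹`
are `id` / `circleConj` up to homotopy), `winding_rotation`.

## References

* A. Hatcher, *Algebraic Topology* (2002), §1.1 Thm. 1.7, Prop. 1.12, Prop. 1.14, Prop. 1.30.
  [HatcherAT2002]
* R. Aranda, A. Zupan, arXiv:2503.04607 (2025), §2 p. 7. [ArandaZupan2025]
-/

-- the registered namespace `Summit.SmoothPoincare4.SmoothPoincare4.Theorems…` repeats a component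
set_option linter.dupNamespace false

noncomputable section

open scoped Manifold ContDiff Topology ContinuousMap Real unitInterval
open Set Function
open Literature.Topology.FourManifolds Literature.Topology.FourManifolds.CircleMaps
open Literature.AlgebraicTopology.FundamentalGroup

namespace Summit.SmoothPoincare4.SmoothPoincare4.Theorems.WeakReductionReduces.LoopDichotomy

/-! ### Group theory: a normally generating class under a homomorphism onto `ℤ` -/

/-- If the class `a` normally generates `G` and a homomorphism `W : G → ℤ` takes the value `1`
somewhere, then `W a = ±1` (the image of the normal closure of `a` lies in the cyclic group
generated by `W a`, `ℤ` being abelian). [folklore] -/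
theorem eq_one_or_neg_one_of_normalClosure_eq_top {G : Type*} [Group G] (W : G →* Multiplicative ℤ)
    {a s : G} (ha : Subgroup.normalClosure {a} = ⊤) (hs : W s = Multiplicative.ofAdd 1) :
    Multiplicative.toAdd (W a) = 1 ∨ Multiplicative.toAdd (W a) = -1 := by
  set K : Subgroup (Multiplicative ℤ) := Subgroup.zpowers (W a) with hK
  have hle : Subgroup.normalClosure {a} ≤ K.comap W := by
    refine Subgroup.normalClosure_le_normal ?_
    intro x hx
    rw [Set.mem_singleton_iff] at hx
    subst hx
    exact Subgroup.mem_zpowers _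
  have hsK : W s ∈ K := by
    have : s ∈ K.comap W := hle (by rw [ha]; exact Subgroup.mem_top s)
    exact this
  rw [hK, Subgroup.mem_zpowers_iff] at hsK
  obtain ⟨k, hk⟩ := hsK
  rw [hs] at hk
  have hk' : k * Multiplicative.toAdd (W a) = 1 := by
    have := congrArg Multiplicative.toAdd hk
    simpa [mul_comm] using this
  rcases Int.eq_one_or_neg_one_of_mul_eq_one' hk' with ⟨-, h⟩ | ⟨-, h⟩
  · exact Or.inl h
  · exact Or.inr h

/-! ### The winding homomorphism of a circle-valued map, evaluated by the tree's `winding` -/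

variable {Y : Type*} [TopologicalSpace Y]

/-- **The winding homomorphism `π₁(Y, y) → π₁(ℝ/ℤ) ≅ ℤ` of `α ∘ F`, for the angle map
`α : e^{is} ↦ s/2π` and a circle-valued `F`, takes on the class of a loop `γ` the value
`winding F γ`** (the tree's winding number of `CircleMapWinding.lean`, defined by the real lift
of `F ∘ γ` through `s ↦ e^{is}`): evaluate the homomorphism by the lift divided by `2π`
(`wind_fromPath_eq_of_lift`, Hatcher 2002, proof of Thm. 1.7). [cite: HatcherAT2002, Thm. 1.7 (p. 29) and its proof] -/
theorem wind_eq_winding (α : C(Circle, AddCircle (1 : ℝ)))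
    (hα : ∀ s : ℝ, α (Circle.exp s) = ((s / (2 * π) : ℝ) : AddCircle (1 : ℝ)))
    (F : C(Y, Circle)) {y : Y} (γ : Path y y) :
    fundamentalGroupAddCircleEquiv one_ne_zero ((α.comp F) y)
        (FundamentalGroup.map (α.comp F) y
          (FundamentalGroup.fromPath (Path.Homotopic.Quotient.mk γ))) =
      Multiplicative.ofAdd (winding F γ) := by
  refine wind_fromPath_eq_of_lift (α.comp F) γ (fun t ↦ liftOf F γ t / (2 * π))
    ((liftOf F γ).continuous.div_const _) (fun t ↦ ?_) (winding F γ) ?_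
  · rw [ContinuousMap.comp_apply, ← exp_liftOf F γ t, hα]
  · have h := incr_eq_winding F γ
    rw [incr] at h
    field_simp
    linarith

/-! ### Circle maps are classified by the degree (Hatcher, Thm. 1.7) -/

/-- **A self-map of the circle group is homotopic to `z ↦ z^d`, `d` its degree** — from the
tree's torus classification `homotopic_monomial_of_degree` applied to `G ∘ pr₁ : T² → S¹`
(degrees `(d, 0)`), restricted to the first coordinate circle. [cite: HatcherAT2002, §1.1 Thm. 1.7] -/
theorem homotopic_zpow_of_degree (G : C(Circle, Circle)) :
    G.Homotopic ((monomial (degree G) 0).comp inclFst) := by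
  have h1 : degree ((G.comp fstC).comp inclFst) = degree G := by
    congr 1
  have h2 : degree ((G.comp fstC).comp inclSnd) = 0 := by
    have : (G.comp fstC).comp inclSnd = ContinuousMap.const Circle (G 1) := by
      ext u; rfl
    rw [this, degree_const]
  have h := (homotopic_monomial_of_degree (G.comp fstC) h1 h2).comp
    (ContinuousMap.Homotopic.refl inclFst)
  exact h

/-- `z ↦ z¹ · 1⁰` is the identity. [folklore] -/
theorem monomial_one_comp_inclFst : (monomial 1 0).comp inclFst = ContinuousMap.id Circle := by
  ext x; simp

/-- `z ↦ z⁻¹ · 1⁰` is inversion. [folklore] -/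
theorem monomial_neg_one_comp_inclFst_apply (x : Circle) :
    (monomial (-1) 0).comp inclFst x = x⁻¹ := by
  simp

/-! ### The Euclidean circle `𝕊¹ ⊆ ℝ²`: conjugation and the transport from `Circle` -/

/-- Under `Circle ≃ₜ 𝕊¹`, inversion `z ↦ z⁻¹` corresponds to `circleConj`. [folklore] -/
theorem symm_inv_apply (u : (Metric.sphere (0 : EuclideanSpace ℝ (Fin 2)) 1)) :
    circleHomeomorphSphereOne ((circleHomeomorphSphereOne.symm u)⁻¹) = circleConj u := by
  obtain ⟨s, rfl⟩ := circlePoint_surjective u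
  rw [circleHomeomorphSphereOne_symm_circlePoint, ← Circle.exp_neg, circleHomeomorphSphereOne_exp,
    circleConj_circlePoint]

/-- **A self-map `f₁` of `𝕊¹` whose conjugate `h⁻¹ ∘ f₁ ∘ h` by `h : Circle ≃ₜ 𝕊¹` has degree
`1` (resp. `-1`) is homotopic to the identity (resp. to `circleConj`)** (Hatcher Thm. 1.7,
transported along `circleHomeomorphSphereOne`). [cite: HatcherAT2002, §1.1 Thm. 1.7] -/
theorem homotopic_id_or_conj_of_degree (f₁ : C((Metric.sphere (0 : EuclideanSpace ℝ (Fin 2)) 1), (Metric.sphere (0 : EuclideanSpace ℝ (Fin 2)) 1))) :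
    (degree ((⟨_, circleHomeomorphSphereOne.symm.continuous⟩ : C((Metric.sphere (0 : EuclideanSpace ℝ (Fin 2)) 1), Circle)).comp
        (f₁.comp ⟨_, circleHomeomorphSphereOne.continuous⟩)) = 1 →
      f₁.Homotopic (ContinuousMap.id _)) ∧
    (degree ((⟨_, circleHomeomorphSphereOne.symm.continuous⟩ : C((Metric.sphere (0 : EuclideanSpace ℝ (Fin 2)) 1), Circle)).comp
        (f₁.comp ⟨_, circleHomeomorphSphereOne.continuous⟩)) = -1 →
      f₁.Homotopic ⟨circleConj, circleConj.continuous⟩) := by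
  set hc : C(Circle, (Metric.sphere (0 : EuclideanSpace ℝ (Fin 2)) 1)) := ⟨_, circleHomeomorphSphereOne.continuous⟩ with hhc
  set hs : C((Metric.sphere (0 : EuclideanSpace ℝ (Fin 2)) 1), Circle) := ⟨_, circleHomeomorphSphereOne.symm.continuous⟩ with hhs
  set G := hs.comp (f₁.comp hc) with hG
  have hback : ∀ P : C(Circle, Circle), G.Homotopic P → f₁.Homotopic (hc.comp (P.comp hs)) := by
    intro P hP
    have h := ((ContinuousMap.Homotopic.refl hc).comp hP).comp (ContinuousMap.Homotopic.refl hs)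
    have heq : (hc.comp G).comp hs = f₁ := by
      ext1 u
      simp [hG, hhc, hhs]
    have heq' : (hc.comp P).comp hs = hc.comp (P.comp hs) := rfl
    rwa [heq, heq'] at h
  have hzpow := homotopic_zpow_of_degree G
  constructor
  · intro hd
    rw [hd, monomial_one_comp_inclFst] at hzpow
    have h := hback _ hzpow
    have heq : hc.comp ((ContinuousMap.id Circle).comp hs) = ContinuousMap.id _ := by
      ext1 u; simp [hhc, hhs]
    rwa [heq] at h
  · intro hd
    rw [hd] at hzpow
    have h := hback _ hzpow
    have heq : hc.comp (((monomial (-1) 0).comp inclFst).comp hs) =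
        ⟨circleConj, circleConj.continuous⟩ := by
      ext1 u
      show circleHomeomorphSphereOne ((monomial (-1) 0).comp inclFst (circleHomeomorphSphereOne.symm u))
        = circleConj u
      rw [monomial_neg_one_comp_inclFst_apply, symm_inv_apply]
    rwa [heq] at h

/-! ### The rotation loop of `𝕊¹ × Y` winds once -/

/-- The loop `t ↦ ((cos (s₀ + 2πt), sin (s₀ + 2πt)), y₀)` of `𝕊¹ × Y` has winding number `1`
with respect to the first coordinate (read in `Circle`): it lifts to `t ↦ s₀ + 2πt`. [folklore] -/
theorem winding_rotation (F : C((Metric.sphere (0 : EuclideanSpace ℝ (Fin 2)) 1) × Y, Circle))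
    (hF : ∀ p, F p = circleHomeomorphSphereOne.symm p.1) (p₀ : (Metric.sphere (0 : EuclideanSpace ℝ (Fin 2)) 1) × Y) (s₀ : ℝ)
    (ρ : Path p₀ p₀)
    (hρ : ∀ t, ρ t = (circlePoint (s₀ + 2 * π * t), p₀.2)) : winding F ρ = 1 := by
  refine winding_eq_of_lift F ρ (G := fun t ↦ s₀ + 2 * π * t) (by fun_prop) (fun t ↦ ?_) 1 ?_
  · rw [hF, hρ, circleHomeomorphSphereOne_symm_circlePoint]
  · simp

/-! ### Loops in `S¹ × S³` -/

/-- **Loops in `S¹ × S³` (Hatcher 2002, Prop. 1.12, Thm. 1.7, Prop. 1.14; Aranda–Zupan 2025,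
§2 p. 7: "let `ℓ_p` be any loop in `S¹ × S³` such that `[ℓ_p] = p ∈ ℤ = π₁(S¹ × S³)` … `ℓ_p` is
well-defined up to isotopy") — PROVED (registered helper).**  A loop `f : 𝕊¹ → 𝕊¹ × 𝕊³` whose
class normally generates `π₁(𝕊¹ × 𝕊³, f(1, 0))` is homotopic to the fibre circle `u ↦ (u, N)`
or to its reverse `u ↦ (ū, N)`.  Proof: the winding homomorphism `W : π₁(𝕊¹ × 𝕊³) → ℤ` of the
angle of the first coordinate takes the value `1` on the rotation loop through the base point,
so `W[f] = ±1` (`eq_one_or_neg_one_of_normalClosure_eq_top`); `W[f]` is the winding number of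
the first coordinate `f₁` (`wind_eq_winding`), i.e. the degree of `h⁻¹ ∘ f₁ ∘ h`, so `f₁` is
homotopic to `id` or to `circleConj` (`homotopic_id_or_conj_of_degree`); the second coordinate
is null-homotopic since `𝕊³` is simply connected (`simplyConnectedSpace_euclideanSphere`,
`ContinuousMap.homotopic_of_simplyConnectedSpace`); combine with `Homotopic.prodMk`.
[cite: HatcherAT2002, Prop. 1.12, Thm. 1.7 and Prop. 1.14] [cite: ArandaZupan2025, §2 p. 7] -/
theorem helper_circleProdSphereThree_loop_homotopic_fibre :
    ∀ (f : C((Metric.sphere (0 : EuclideanSpace ℝ (Fin 2)) 1), (Metric.sphere (0 : EuclideanSpace ℝ (Fin 2)) 1) × (Metric.sphere (0 : EuclideanSpace ℝ (Fin 4)) 1))), Subgroup.normalClosure {(FundamentalGroup.fromPath (Path.Homotopic.Quotient.mk f.circleLoop) : FundamentalGroup ((Metric.sphere (0 : EuclideanSpace ℝ (Fin 2)) 1) × (Metric.sphere (0 : EuclideanSpace ℝ (Fin 4)) 1)) (f (Literature.Topology.FourManifolds.circlePoint 0)))} = ⊤ → f.Homotopic ((ContinuousMap.id (Metric.sphere (0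 : EuclideanSpace ℝ (Fin 2)) 1)).prodMk (ContinuousMap.const (Metric.sphere (0 : EuclideanSpace ℝ (Fin 2)) 1) Literature.Topology.FourManifolds.SphereFourSurgery.northPole)) ∨ f.Homotopic ((⟨⇑Literature.Topology.FourManifolds.circleConj, Literature.Topology.FourManifolds.circleConj.continuous⟩ : C((Metric.sphere (0 : EuclideanSpace ℝ (Fin 2)) 1), (Metric.sphere (0 : EuclideanSpace ℝ (Fin 2)) 1))).prodMk (ContinuousMap.const (Metric.sphere (0 : EuclideanSpace ℝ (Fin 2)) 1) Literature.Topology.FourManifolds.SphereFourSurgery.northPole)) := by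
  intro f hN
  -- the angle map `α : Circle → ℝ/ℤ`, `e^{is} ↦ s / 2π`
  let α : C(Circle, AddCircle (1 : ℝ)) :=
    ⟨(AddCircle.homeomorphAddCircle (2 * π) 1 (by positivity) one_ne_zero) ∘
        (AddCircle.homeomorphCircle'.symm : Circle → AddCircle (2 * π)), by fun_prop⟩
  have hα : ∀ s : ℝ, α (Circle.exp s) = ((s / (2 * π) : ℝ) : AddCircle (1 : ℝ)) := by
    intro s
    show AddCircle.homeomorphAddCircle (2 * π) 1 _ _ (AddCircle.homeomorphCircle'.symm (Circle.exp s)) = _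
    have h1 : AddCircle.homeomorphCircle'.symm (Circle.exp s) = ((s : ℝ) : AddCircle (2 * π)) := by
      rw [Homeomorph.symm_apply_eq, AddCircle.homeomorphCircle'_apply_mk]
    rw [h1, AddCircle.homeomorphAddCircle_apply_mk]
    congr 1
    ring
  -- the circle-valued first coordinate `F = h⁻¹ ∘ pr₁`
  let hs : C((Metric.sphere (0 : EuclideanSpace ℝ (Fin 2)) 1), Circle) := ⟨_, circleHomeomorphSphereOne.symm.continuous⟩
  let hc : C(Circle, (Metric.sphere (0 : EuclideanSpace ℝ (Fin 2)) 1)) := ⟨_, circleHomeomorphSphereOne.continuous⟩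
  let pr₁ : C((Metric.sphere (0 : EuclideanSpace ℝ (Fin 2)) 1) × (Metric.sphere (0 : EuclideanSpace ℝ (Fin 4)) 1), (Metric.sphere (0 : EuclideanSpace ℝ (Fin 2)) 1)) := ⟨Prod.fst, continuous_fst⟩
  let pr₂ : C((Metric.sphere (0 : EuclideanSpace ℝ (Fin 2)) 1) × (Metric.sphere (0 : EuclideanSpace ℝ (Fin 4)) 1), (Metric.sphere (0 : EuclideanSpace ℝ (Fin 4)) 1)) := ⟨Prod.snd, continuous_snd⟩
  let F : C((Metric.sphere (0 : EuclideanSpace ℝ (Fin 2)) 1) × (Metric.sphere (0 : EuclideanSpace ℝ (Fin 4)) 1), Circle) := hs.comp pr₁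
  -- the winding homomorphism of `α ∘ F` and the rotation loop through the base point
  set p₀ := f (circlePoint 0) with hp₀
  let θ : C((Metric.sphere (0 : EuclideanSpace ℝ (Fin 2)) 1) × (Metric.sphere (0 : EuclideanSpace ℝ (Fin 4)) 1), AddCircle (1 : ℝ)) := α.comp F
  let W : FundamentalGroup ((Metric.sphere (0 : EuclideanSpace ℝ (Fin 2)) 1) × (Metric.sphere (0 : EuclideanSpace ℝ (Fin 4)) 1)) p₀ →* Multiplicative ℤ :=
    (fundamentalGroupAddCircleEquiv one_ne_zero (θ p₀)).toMonoidHom.comp (FundamentalGroup.map θ p₀)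
  obtain ⟨s₀, hs₀⟩ := circlePoint_surjective p₀.1
  let ρ : Path p₀ p₀ :=
    { toFun := fun t ↦ (circlePoint (s₀ + 2 * π * t), p₀.2)
      continuous_toFun := by fun_prop
      source' := by simp [hs₀]
      target' := by
        simp only [Set.Icc.coe_one, mul_one]
        rw [circlePoint_add_two_pi, hs₀] }
  have hWρ : W (FundamentalGroup.fromPath (Path.Homotopic.Quotient.mk ρ)) = Multiplicative.ofAdd 1 := by
    show fundamentalGroupAddCircleEquiv one_ne_zero (θ p₀) (FundamentalGroup.map θ p₀ _) = _
    rw [wind_eq_winding α hα F ρ, winding_rotation F (fun p ↦ rfl) p₀ s₀ ρ (fun t ↦ rfl)]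
  have hWf : W (FundamentalGroup.fromPath (Path.Homotopic.Quotient.mk f.circleLoop)) =
      Multiplicative.ofAdd (winding F f.circleLoop) := wind_eq_winding α hα F f.circleLoop
  -- hence the winding of `pr₁ ∘ f` is `±1`
  have hpm := eq_one_or_neg_one_of_normalClosure_eq_top W hN hWρ
  rw [hWf] at hpm
  simp only [toAdd_ofAdd] at hpm
  -- and it is the degree of the conjugated circle map
  set f₁ : C((Metric.sphere (0 : EuclideanSpace ℝ (Fin 2)) 1), (Metric.sphere (0 : EuclideanSpace ℝ (Fin 2)) 1)) := pr₁.comp f with hf₁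
  have hdeg : degree (hs.comp (f₁.comp hc)) = winding F f.circleLoop := by
    refine winding_congr _ _ _ _ fun t ↦ ?_
    show circleHomeomorphSphereOne.symm (f (circleHomeomorphSphereOne (Circle.exp (2 * π * t)))).1 =
      circleHomeomorphSphereOne.symm (f (circleParam t)).1
    rw [circleHomeomorphSphereOne_exp]
    rfl
  -- the second coordinate is null-homotopic (`(Metric.sphere (0 : EuclideanSpace ℝ (Fin 4)) 1)` is simply connected)
  haveI : SimplyConnectedSpace (Metric.sphere (0 : EuclideanSpace ℝ (Fin 4)) 1) :=
    Literature.Topology.FourManifolds.simplyConnectedSpace_euclideanSphere (n := 3) (by norm_num)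
  have h₂ : (pr₂.comp f).Homotopic (ContinuousMap.const (Metric.sphere (0 : EuclideanSpace ℝ (Fin 2)) 1) SphereFourSurgery.northPole) :=
    ContinuousMap.homotopic_of_simplyConnectedSpace _ _
  have hsplit : f = f₁.prodMk (pr₂.comp f) := by ext1 u; rfl
  obtain ⟨hid, hconj⟩ := homotopic_id_or_conj_of_degree f₁
  rcases hpm with h | h
  · left
    rw [hsplit]
    exact (hid (hdeg.trans h)).prodMk h₂
  · right
    rw [hsplit]
    exact (hconj (hdeg.trans h)).prodMk h₂

end Summit.SmoothPoincare4.SmoothPoincare4.Theorems.WeakReductionReduces.LoopDichotomy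

end
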